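/-
Copyright (c) 2026 the pub-hodgecm-mathlib formalisation cell (harness21).  Prover seat hodgecm-mathlib-K2E1-p03 (g0), Track B ∕ K2-LIT (stream 29),
h413 = `stmt-HodgeConjecture-24833`, line `K2_E1_TraceFormulaBeta`, `[L⁺:ℚ] = 1` TRANSPORT package file 3 (dealer K2E1-plan (g0) BY-NAME DEAL (3)
2026-09-03T21:22:33Z): TWO PLACES OF `ℚ(√d)` ABOVE `p` from a `p`-adic square root of `d`.  2026-09-03.
-/
import Mathlib.NumberTheory.NumberField.InfinitePlace.TotallyRealComplex   -- `NumberField.IsTotallyReal`, `𝓞 K`, infinite places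
import Mathlib.NumberTheory.Padics.RingHoms                                -- `PadicInt.toZMod`, `PadicInt.exists_mem_range`, `ker_toZMod`
import Mathlib.RingTheory.DedekindDomain.AdicValuation                     -- `IsDedekindDomain.HeightOneSpectrum`
import Mathlib.FieldTheory.IntermediateField.Adjoin.Basic                  -- `IntermediateField.algHomAdjoinIntegralEquiv`
import Mathlib.FieldTheory.Minpoly.Basic                                   -- `minpoly.two_le_natDegree_iff`
import Mathlib.Data.Rat.Lemmas                                             -- `Rat.isSquare_natCast_iff`
import Mathlib.Tactic.ComputeDegree                                        -- `monicity!`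
import HarnessLib

/-!
# h413 ∕ Track B «K2-LIT», line `K2_E1_TraceFormulaBeta`, TRANSPORT package file 3: `p` SPLITS IN THE REAL QUADRATIC FIELD `ℚ(√d)` WHEN `d` IS A `p`-ADIC SQUARE
# (helper `K2E1RealQuadraticTwoPlacesAboveP`, dealt BY NAME by K2E1-plan (g0) on `K2/STATUS.md` 2026-09-03T21:22:33Z; input №2 of HELD row 21 `K2E1TransportRealQuadratic`)

Cell `pub/hodgecm-mathlib`, crux H413 = `stmt-HodgeConjecture-24833`, route `HCCMUnconditional`; chair K2-lead (g0), dealer K2E1-plan (g0).  THEOREMS ONLY (no `def`,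
no `instance`, no `notation`, no named-fact hypothesis, no `sorry`); imports = Mathlib + HarnessLib; lane `--supports stmt-HodgeConjecture-24833 --as helper`
(count-neutral).  Chain: ★ `K2E1SquarefreeOneModEightP` → ★ `K2E1RealQuadraticSplitAtP` (`d` a square in `ℚ_p`, `ℚ_2`) → THIS FILE (two places of `ℚ(√d)` above `p`).

THE CURRENCY (dealer: «the Mathlib currency you find most tie-able»).  ANY model of `ℚ(√d)`: a number field `K`, `θ : K`, `θ ^ 2 = d`, `∀ x : K, ∃ a b : ℚ,
x = a + b • θ`; `d : ℕ` squarefree, `1 < d` (so `[K:ℚ] = 2`); `p` prime as the INSTANCE `[Fact p.Prime]` (needed by `ℚ_[p]`); places = Mathlib's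
`IsDedekindDomain.HeightOneSpectrum (𝓞 K)`; «`v` lies above `p`» = `((p : ℤ) : 𝓞 K) ∈ v.asIdeal`.

THE STATEMENTS.  **`RealQuadraticTwoPlacesAboveP`** · `Squarefree d → 1 < d → IsSquare (d : ℚ_[p]) → (θ² = d, K = ℚ + ℚθ) →
∃ v₁ v₂ : HeightOneSpectrum (𝓞 K), v₁ ≠ v₂ ∧ (p : 𝓞 K) ∈ v₁.asIdeal ∧ (p : 𝓞 K) ∈ v₂.asIdeal` — ONE theorem for every prime `p` (no odd∕even split in the
statement; the proof splits) · `RealQuadraticIsTotallyReal` · `θ² = d`, `K = ℚ + ℚθ` (`d : ℕ`) ⇒ `NumberField.IsTotallyReal K`.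

THE MATHEMATICS (p-ADIC PLACES; no Kummer–Dedekind, no factorisation of `p𝓞_K`).  Let `x ∈ ℚ_p`, `x² = d`.  Since `d` is squarefree, `x` is a UNIT
(`‖x‖ < 1` would give `p² ∣ d`).  The minimal polynomial of `θ` is `X² − d` (irreducible: `d` is not a rational square), so there are ring maps
`σ± : K → ℚ_p` with `σ±(θ) = ±x` (Mathlib `IntermediateField.algHomAdjoinIntegralEquiv` on `ℚ⟮θ⟯ = K`).  Algebraic integers land in `ℤ_p`
(integral over `ℤ`, `ℤ_p` integrally closed in `ℚ_p`), so `P± = {a ∈ 𝓞 K : ‖σ±(a)‖ < 1}` is the pull-back of the maximal ideal of `ℤ_p` along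
`𝓞 K → ℤ_p`: a prime ideal, containing `p`, hence non-zero — a height-one prime `v±`.  SEPARATION `P₊ ≠ P₋` by one algebraic integer `u` with
`¬ (‖σ₊ u‖ < 1 ↔ ‖σ₋ u‖ < 1)`: * `p` odd: `u = θ − s`, `s ∈ ℕ` with `‖x − s‖ < 1` (residue of `x`); then `σ₊u = x − s ∈ 𝔪` while `σ₋u = −x − s ∉ 𝔪`, since otherwise
  `2x = (x − s) − (−x − s) ∈ 𝔪`, but `‖2x‖ = ‖2‖·‖x‖ = 1`;
* `p = 2`: the unit `x` is `1 + 2w`, `w ∈ ℤ_2`, and `w(w + 1) ∈ 𝔪` (residues in `𝔽₂`), so `d − 1 = x² − 1 = 4w(w + 1)` has `‖d − 1‖₂ ≤ 2⁻³`, i.e.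
  `8 ∣ d − 1`; hence `u = (1 + θ)/2` is an algebraic integer (root of `X² − X − (d − 1)/4`), and `σ₊u = 1 + w`, `σ₋u = −w`: if `‖w‖ < 1` then
  `‖1 + w‖ = 1`; if `‖w‖ = 1` then `‖1 + w‖ = ‖w(w+1)‖ < 1` — exactly one of them lies in `𝔪`.
Totally real: for `φ : K → ℂ`, `(φθ)² = d ≥ 0` forces `φθ ∈ ℝ`, and `K = ℚ + ℚθ`.  [folklore: Neukirch, *Algebraic Number Theory* I (8.5) & II §8]
§1 `norm_ringHom_le_one`, `exists_heightOneSpectrum_of_ringHom` (the place of an embedding) · §2 `norm_eq_one_of_sq_eq`, `isIntegral_of_sq_eq`,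
`exists_separating_odd`, `exists_separating_two` · §3 `not_isSquare_natCast`, `minpoly_eq_X_sq_sub_C`, `adjoin_simple_eq_top`, `exists_ringHom_apply_eq`
(the embeddings `θ ↦ ±x`) · §4 **`RealQuadraticTwoPlacesAboveP`**, `RealQuadraticIsTotallyReal`.

WHAT IS NOT HERE.  That these are ALL the places above `p`, `e = f = 1`, the completions `K_{v±} ≅ ℚ_p`, and the compositum `L ↦ L·K` bookkeeping of
HELD row 21 `K2E1TransportRealQuadratic` (behind its DEFS leaf, dealer's table `Lines/K2_E1_TraceFormulaBetaSigs_TABLE.md`).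

HONEST LABEL.  HC_CM is proved only modulo the 7 printed citations (2 named inputs: hLiu418 = 24832, h413 = 24833) until rung 0 closes; count-neutral.

## References
* J. Neukirch, *Algebraic Number Theory*, Grundlehren 322 (1999), Ch. I Prop. 8.5 (splitting of `p` in `ℚ(√d)`), Ch. II §8 (primes ↔ embeddings); folklore.
* [Rogawski1990] J. Rogawski, *Automorphic representations of unitary groups in three variables*, Ann. of Math. Stud. 123 (1990), §13.8 p. 218 (context only).
-/

set_option autoImplicit false
set_option linter.dupNamespace false  -- the mandated namespace repeats the summit's segment (`HodgeConjecture.HodgeConjecture`)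

namespace Summit.HodgeConjecture.HodgeConjecture.Cruxes.H413.K2E1RealQuadraticTwoPlacesAboveP

open Polynomial IntermediateField NumberField

variable {K : Type*} [Field K]

/-! ## §1 The place of an embedding `σ : K →+* ℚ_[p]` -/

/-- **Algebraic integers are `p`-adic integers under any embedding.**  For `σ : K →+* ℚ_p` and `a ∈ 𝓞 K`, `‖σ a‖ ≤ 1`: `σ a` is integral over
`ℤ`, hence over `ℤ_p`, and `ℤ_p` is integrally closed in its fraction field `ℚ_p`.  [folklore] -/
theorem norm_ringHom_le_one {p : ℕ} [Fact p.Prime] (σ : K →+* ℚ_[p]) (a : 𝓞 K) : ‖σ a‖ ≤ 1 := by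
  have ha : IsIntegral ℤ (σ (a : K)) := map_isIntegral_int σ (RingOfIntegers.isIntegral_coe a)
  have ha' : IsIntegral ℤ_[p] (σ (a : K)) := ha.tower_top
  obtain ⟨z, hz⟩ := (IsIntegrallyClosed.isIntegral_iff (R := ℤ_[p]) (K := ℚ_[p])).mp ha'
  rw [← hz]
  exact PadicInt.norm_le_one z

/-- **The place of an embedding.**  For a number field `K` and `σ : K →+* ℚ_p` there is a height-one prime `v` of `𝓞 K` lying above `p` whose
ideal is `{a ∈ 𝓞 K : ‖σ a‖ < 1}` — the pull-back of the maximal ideal of `ℤ_p` along `a ↦ σ a : 𝓞 K →+* ℤ_p` (`norm_ringHom_le_one`); it is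
prime as the pull-back of a prime, contains `p` (`‖p‖_p < 1`), hence is non-zero.  [folklore] -/
theorem exists_heightOneSpectrum_of_ringHom [NumberField K] {p : ℕ} [Fact p.Prime] (σ : K →+* ℚ_[p]) :
    ∃ v : IsDedekindDomain.HeightOneSpectrum (𝓞 K),
      ((p : ℤ) : 𝓞 K) ∈ v.asIdeal ∧ ∀ a : 𝓞 K, a ∈ v.asIdeal ↔ ‖σ a‖ < 1 := by
  let τ : 𝓞 K →+* ℤ_[p] :=
    { toFun := fun a => ⟨σ a, norm_ringHom_le_one σ a⟩
      map_one' := PadicInt.ext (by simp)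
      map_mul' := fun a b => PadicInt.ext (by simp)
      map_zero' := PadicInt.ext (by simp)
      map_add' := fun a b => PadicInt.ext (by simp) }
  let P : Ideal (𝓞 K) := Ideal.comap τ (IsLocalRing.maximalIdeal ℤ_[p])
  have hPmem : ∀ a : 𝓞 K, a ∈ P ↔ ‖σ a‖ < 1 := fun a => by
    rw [Ideal.mem_comap, IsLocalRing.mem_maximalIdeal, PadicInt.mem_nonunits]
    rfl
  have hPprime : P.IsPrime := Ideal.comap_isPrime τ _
  have hp : ((p : ℤ) : 𝓞 K) ∈ P := by
    rw [hPmem]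
    simp only [Int.cast_natCast, RingOfIntegers.coe_eq_algebraMap]
    simpa using Padic.norm_p_lt_one (p := p)
  have hPne : P ≠ ⊥ := by
    intro h
    rw [h, Ideal.mem_bot] at hp
    exact (Int.cast_ne_zero.mpr (by exact_mod_cast (Fact.out : p.Prime).ne_zero)) hp
  exact ⟨⟨P, hPprime, hPne⟩, hp, hPmem⟩

/-! ## §2 Units and separating algebraic integers -/

/-- **A `p`-adic square root of a squarefree integer is a unit.**  If `x² = d` in `ℚ_p` with `d ∈ ℕ` squarefree then `‖x‖ = 1`: `‖x‖² = ‖d‖ ≤ 1`,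
and `‖x‖ < 1` would give `x ∈ pℤ_p`, `‖d‖ ≤ p⁻²`, `p² ∣ d`.  [folklore] -/
theorem norm_eq_one_of_sq_eq {p : ℕ} [Fact p.Prime] (d : ℕ) (hd : Squarefree d) (x : ℚ_[p])
    (hx : x ^ 2 = (d : ℚ_[p])) : ‖x‖ = 1 := by
  have hp : (p : ℕ).Prime := Fact.out
  have hxle2 : ‖x‖ ^ 2 ≤ 1 := by
    rw [← norm_pow, hx]
    exact_mod_cast Padic.norm_int_le_one (p := p) (d : ℤ)
  have hxle : ‖x‖ ≤ 1 := by
    nlinarith [norm_nonneg x]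
  by_contra hne
  have hlt : ‖x‖ < 1 := lt_of_le_of_ne hxle hne
  set z : ℤ_[p] := ⟨x, hxle⟩ with hz
  have hzlt : ‖z‖ < 1 := hlt
  rw [PadicInt.norm_lt_one_iff_dvd] at hzlt
  obtain ⟨y, hy⟩ := hzlt
  have hd2 : ‖((d : ℤ) : ℤ_[p])‖ ≤ (p : ℝ) ^ (-(2 : ℕ) : ℤ) := by
    have hzd : ((d : ℤ) : ℤ_[p]) = z ^ 2 := by
      apply PadicInt.ext
      rw [hz]
      push_cast
      exact hx.symm
    rw [hzd, hy, mul_pow, norm_mul, norm_pow, PadicInt.norm_p]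
    have : ‖y ^ 2‖ ≤ 1 := PadicInt.norm_le_one _
    have hp0 : (0 : ℝ) ≤ (p : ℝ)⁻¹ ^ 2 := by positivity
    calc (p : ℝ)⁻¹ ^ 2 * ‖y ^ 2‖ ≤ (p : ℝ)⁻¹ ^ 2 * 1 := by gcongr
      _ = (p : ℝ) ^ (-(2 : ℕ) : ℤ) := by rw [mul_one, zpow_neg, zpow_natCast, inv_pow]
  rw [PadicInt.norm_int_le_pow_iff_dvd] at hd2
  have hpp : p * p ∣ d := by exact_mod_cast (sq (p : ℤ)) ▸ hd2
  exact hp.ne_one (Nat.isUnit_iff.mp (hd p hpp))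

/-- `θ` with `θ² = d ∈ ℕ` is an algebraic integer (root of the monic `X² − d ∈ ℤ[X]`).  [folklore] -/
theorem isIntegral_of_sq_eq (d : ℕ) (θ : K) (hθ : θ ^ 2 = (d : K)) : IsIntegral ℤ θ := by
  refine ⟨X ^ 2 - C (d : ℤ), monic_X_pow_sub_C _ two_ne_zero, ?_⟩
  simp [hθ]

/-- **Separating integer, `p` odd.**  With `x² = d` (`d` squarefree) in `ℚ_p`, `p ≠ 2`, and embeddings `σ₁ θ = x`, `σ₂ θ = −x`, the algebraic
integer `u = θ − s` (`s ∈ ℕ` the residue of the unit `x`, `‖x − s‖ < 1`) has `‖σ₁ u‖ < 1` but not `‖σ₂ u‖ < 1`: else `‖2x‖ = ‖(x − s) − (−x − s)‖ < 1`,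
whereas `‖2‖ = ‖x‖ = 1`.  [folklore] -/
theorem exists_separating_odd {p : ℕ} [Fact p.Prime] (hp2 : p ≠ 2) (d : ℕ) (hd : Squarefree d) (θ : K)
    (hθ : θ ^ 2 = (d : K)) (x : ℚ_[p]) (hx : x ^ 2 = (d : ℚ_[p]))
    (σ₁ σ₂ : K →+* ℚ_[p]) (h₁ : σ₁ θ = x) (h₂ : σ₂ θ = -x) :
    ∃ u : 𝓞 K, ¬ (‖σ₁ u‖ < 1 ↔ ‖σ₂ u‖ < 1) := by
  have hp : (p : ℕ).Prime := Fact.out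
  have hxn : ‖x‖ = 1 := norm_eq_one_of_sq_eq d hd x hx
  set z : ℤ_[p] := ⟨x, hxn.le⟩ with hz
  obtain ⟨s, -, hs⟩ := PadicInt.exists_mem_range z
  rw [IsLocalRing.mem_maximalIdeal, PadicInt.mem_nonunits] at hs
  have hs' : ‖x - s‖ < 1 := by simpa [PadicInt.norm_def, hz] using hs
  -- `‖2‖_p = 1` for `p` odd
  have h2 : ‖(2 : ℚ_[p])‖ = 1 := by
    have hle : ‖((2 : ℤ) : ℚ_[p])‖ ≤ 1 := Padic.norm_int_le_one 2
    have hnlt : ¬ ‖((2 : ℤ) : ℚ_[p])‖ < 1 := by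
      rw [Padic.norm_intCast_lt_one_iff]
      intro h
      have : p ∣ 2 := by exact_mod_cast h
      exact hp2 ((Nat.prime_dvd_prime_iff_eq hp Nat.prime_two).mp this)
    push_cast at hle hnlt
    exact le_antisymm hle (not_lt.mp hnlt)
  refine ⟨⟨θ, isIntegral_of_sq_eq d θ hθ⟩ - s, ?_⟩
  have e₁ : σ₁ ((⟨θ, isIntegral_of_sq_eq d θ hθ⟩ - s : 𝓞 K) : K) = x - s := by
    simp [h₁]
  have e₂ : σ₂ ((⟨θ, isIntegral_of_sq_eq d θ hθ⟩ - s : 𝓞 K) : K) = -x - s := by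
    simp [h₂]
  rw [e₁, e₂]
  intro hiff
  have hlt : ‖-x - s‖ < 1 := hiff.mp hs'
  have h2x : ‖(2 : ℚ_[p]) * x‖ < 1 := by
    have heq : (2 : ℚ_[p]) * x = (x - s) + -(-x - s) := by ring
    rw [heq]
    exact lt_of_le_of_lt (Padic.nonarchimedean _ _) (max_lt hs' (by rwa [norm_neg]))
  rw [norm_mul, h2, hxn, one_mul] at h2x
  exact lt_irrefl _ h2x

/-- **Separating integer, `p = 2`.**  With `x² = d` (`d` squarefree) in `ℚ_2` and embeddings `σ₁ θ = x`, `σ₂ θ = −x`: the unit `x` is `1 + 2w`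
(`w ∈ ℤ_2`) and `w(w + 1) ∈ 𝔪` (residues in `𝔽₂`), so `d − 1 = 4w(w + 1)` gives `8 ∣ d − 1`, `u = (1 + θ)/2` is an algebraic integer (root of
`X² − X − (d − 1)/4`), and `σ₁ u = 1 + w`, `σ₂ u = −w`, of which EXACTLY ONE has norm `< 1` (`‖w‖ < 1 ⇒ ‖1 + w‖ = 1`; `‖w‖ = 1 ⇒ ‖1 + w‖ = ‖w(w+1)‖ < 1`).
This is where `d ≡ 1 (mod 8)` — «`2` splits in `ℚ(√d)`» — is used.  [folklore] -/
theorem exists_separating_two [NumberField K] (d : ℕ) (hd : Squarefree d) (θ : K)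
    (hθ : θ ^ 2 = (d : K)) (x : ℚ_[2]) (hx : x ^ 2 = (d : ℚ_[2]))
    (σ₁ σ₂ : K →+* ℚ_[2]) (h₁ : σ₁ θ = x) (h₂ : σ₂ θ = -x) :
    ∃ u : 𝓞 K, ¬ (‖σ₁ u‖ < 1 ↔ ‖σ₂ u‖ < 1) := by
  have hxn : ‖x‖ = 1 := norm_eq_one_of_sq_eq d hd x hx
  set z : ℤ_[2] := ⟨x, hxn.le⟩ with hz
  have hzx : (z : ℚ_[2]) = x := rfl
  have hzn : ‖z‖ = 1 := hxn
  -- (1) `z - 1 ∈ 𝔪 = (2)`: the residue of the unit `z` in `ZMod 2` is `1`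
  have hz1 : z - 1 ∈ IsLocalRing.maximalIdeal ℤ_[2] := by
    have hz0 : z ∉ IsLocalRing.maximalIdeal ℤ_[2] := by
      rw [IsLocalRing.mem_maximalIdeal, PadicInt.mem_nonunits, hzn]; exact lt_irrefl _
    rw [← PadicInt.ker_toZMod, RingHom.mem_ker] at hz0 ⊢
    rw [map_sub, map_one]
    generalize PadicInt.toZMod z = t at hz0 ⊢
    revert t; decide
  rw [PadicInt.maximalIdeal_eq_span_p, Ideal.mem_span_singleton] at hz1
  obtain ⟨w, hw⟩ := hz1
  have hzw : z = 1 + 2 * w := by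
    have h := hw
    push_cast at h
    linear_combination h
  -- (2) `w (w + 1) ∈ 𝔪`
  have hww : ‖w * (w + 1)‖ < 1 := by
    rw [← PadicInt.mem_nonunits, ← IsLocalRing.mem_maximalIdeal, ← PadicInt.ker_toZMod, RingHom.mem_ker,
      map_mul, map_add, map_one]
    generalize PadicInt.toZMod w = t
    revert t; decide
  have h2n : ‖(2 : ℤ_[2])‖ = (2 : ℝ)⁻¹ := by simpa using PadicInt.norm_p (p := 2)
  have hww' : ‖w * (w + 1)‖ ≤ (2 : ℝ)⁻¹ := by
    -- an element of `𝔪 = (2)` has norm `≤ ‖2‖`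
    have hmem : w * (w + 1) ∈ IsLocalRing.maximalIdeal ℤ_[2] := by
      rw [IsLocalRing.mem_maximalIdeal, PadicInt.mem_nonunits]; exact hww
    rw [PadicInt.maximalIdeal_eq_span_p, Ideal.mem_span_singleton] at hmem
    obtain ⟨v, hv⟩ := hmem
    rw [hv, norm_mul]
    calc ‖((2 : ℕ) : ℤ_[2])‖ * ‖v‖ ≤ ‖((2 : ℕ) : ℤ_[2])‖ * 1 := by gcongr; exact PadicInt.norm_le_one v
      _ = (2 : ℝ)⁻¹ := by rw [mul_one]; simpa using h2n
  -- (3) `8 ∣ d - 1` in `ℤ`: `d - 1 = z² - 1 = 4 w (w + 1)` has norm `≤ 2⁻³`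
  have hz2 : z ^ 2 = (d : ℤ_[2]) := PadicInt.ext (by rw [PadicInt.coe_pow, PadicInt.coe_natCast, hzx, hx])
  have hd8 : ((2 : ℕ) ^ 3 : ℤ) ∣ (d : ℤ) - 1 := by
    refine (PadicInt.norm_int_le_pow_iff_dvd (p := 2) (k := (d : ℤ) - 1) (n := 3)).mp ?_
    have hdz : (((d : ℤ) - 1 : ℤ) : ℤ_[2]) = (2 : ℤ_[2]) ^ 2 * (w * (w + 1)) := by
      push_cast
      rw [← hz2, hzw]
      ring
    rw [hdz, norm_mul, norm_pow, h2n]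
    calc (2 : ℝ)⁻¹ ^ 2 * ‖w * (w + 1)‖ ≤ (2 : ℝ)⁻¹ ^ 2 * (2 : ℝ)⁻¹ := by gcongr
      _ = _ := by norm_num
  obtain ⟨e, he⟩ := hd8
  -- (4) `u = (1 + θ)/2` is an algebraic integer: a root of `X² - X - 2e`, where `d - 1 = 8e`
  have hdK : (d : K) = 8 * (e : K) + 1 := by
    have h := congrArg (Int.cast : ℤ → K) he
    push_cast at h
    linear_combination h
  have hmon : (X ^ 2 - X - C (2 * e) : ℤ[X]).Monic := by monicity!
  have hu : IsIntegral ℤ ((1 + θ) / 2 : K) := by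
    refine ⟨X ^ 2 - X - C (2 * e), hmon, ?_⟩
    simp only [eval₂_sub, eval₂_X_pow, eval₂_X, eval₂_C]
    simp only [eq_intCast]
    push_cast
    linear_combination (1 / 4 : K) * hθ + (1 / 4 : K) * hdK
  refine ⟨⟨(1 + θ) / 2, hu⟩, ?_⟩
  -- (5) `σ₁ u = 1 + w`, `σ₂ u = -w`
  have hx' : x = 1 + 2 * (w : ℚ_[2]) := by
    have h := congrArg ((↑) : ℤ_[2] → ℚ_[2]) hzw
    rw [hzx] at h
    rw [h]
    push_cast
    norm_cast
  have e₁ : σ₁ ((1 + θ) / 2) = 1 + (w : ℚ_[2]) := by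
    rw [map_div₀, map_add, map_one, h₁, map_ofNat, hx']
    ring
  have e₂ : σ₂ ((1 + θ) / 2) = -(w : ℚ_[2]) := by
    rw [map_div₀, map_add, map_one, h₂, map_ofNat, hx']
    ring
  show ¬ (‖σ₁ ((1 + θ) / 2)‖ < 1 ↔ ‖σ₂ ((1 + θ) / 2)‖ < 1)
  rw [e₁, e₂, norm_neg]
  -- (6) exactly one of `1 + w`, `w` lies in `𝔪`
  have hw1 : ‖(w : ℚ_[2])‖ ≤ 1 := w.2
  by_cases hw : ‖(w : ℚ_[2])‖ < 1
  · have h1w : ‖(1 : ℚ_[2]) + w‖ = 1 := by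
      rw [Padic.add_eq_max_of_ne (by rw [norm_one]; exact hw.ne'), norm_one, max_eq_left hw.le]
    rw [h1w]
    intro hiff
    exact lt_irrefl _ (hiff.mpr hw)
  · have hweq : ‖(w : ℚ_[2])‖ = 1 := le_antisymm hw1 (not_lt.mp hw)
    have h1w : ‖(1 : ℚ_[2]) + w‖ < 1 := by
      have h := hww
      rw [PadicInt.norm_def] at h
      push_cast at h
      rw [norm_mul, hweq, one_mul, add_comm] at h
      exact h
    intro hiff
    exact hw (hiff.mp h1w)

/-! ## §3 The embeddings `θ ↦ ±x` of `K = ℚ(θ)` into `ℚ_p` -/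

/-- A squarefree `d > 1` is not a rational square (`Rat.isSquare_natCast_iff`; a squarefree perfect square is `1`).  [folklore] -/
theorem not_isSquare_natCast (d : ℕ) (hd : Squarefree d) (h1 : 1 < d) : ¬ IsSquare ((d : ℕ) : ℚ) := by
  rw [Rat.isSquare_natCast_iff]
  rintro ⟨r, hr⟩
  have hr1 : IsUnit r := hd r ⟨1, by rw [hr, mul_one]⟩
  rw [Nat.isUnit_iff] at hr1
  subst hr1
  omega

variable [NumberField K]

/-- **Minimal polynomial.**  In a number field, `θ` with `θ² = d`, `d` squarefree `> 1`, has `minpoly ℚ θ = X² − d`: the minimal polynomial divides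
`X² − d`, and has degree `≥ 2` because `θ ∉ ℚ` (`d` is not a rational square).  [folklore] -/
theorem minpoly_eq_X_sq_sub_C (d : ℕ) (hd : Squarefree d) (h1 : 1 < d) (θ : K) (hθ : θ ^ 2 = (d : K)) :
    minpoly ℚ θ = X ^ 2 - C (d : ℚ) := by
  have hmonic : (X ^ 2 - C (d : ℚ) : ℚ[X]).Monic := monic_X_pow_sub_C _ two_ne_zero
  have hroot : aeval θ (X ^ 2 - C (d : ℚ) : ℚ[X]) = 0 := by simp [hθ]
  have hint : IsIntegral ℚ θ := .of_finite ℚ θ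
  have hdvd : minpoly ℚ θ ∣ X ^ 2 - C (d : ℚ) := minpoly.dvd ℚ θ hroot
  have h2 : 2 ≤ (minpoly ℚ θ).natDegree := by
    rw [minpoly.two_le_natDegree_iff hint]
    rintro ⟨r, hr⟩
    apply not_isSquare_natCast d hd h1
    refine ⟨r, ?_⟩
    have h : (algebraMap ℚ K) (r * r) = (algebraMap ℚ K) (d : ℚ) := by
      rw [map_mul, hr, ← sq, hθ, map_natCast]
    exact ((algebraMap ℚ K).injective h).symm
  symm
  refine Polynomial.eq_of_monic_of_dvd_of_natDegree_le (minpoly.monic hint) hmonic hdvd ?_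
  rw [natDegree_X_pow_sub_C]; exact h2

/-- `K = ℚ + ℚθ` ⇒ `ℚ⟮θ⟯ = ⊤`.  [folklore] -/
theorem adjoin_simple_eq_top (θ : K) (hgen : ∀ x : K, ∃ a b : ℚ, x = a + b • θ) : ℚ⟮θ⟯ = ⊤ := by
  rw [eq_top_iff]
  intro x _
  obtain ⟨a, b, rfl⟩ := hgen x
  refine add_mem ?_ (smul_mem _ (mem_adjoin_simple_self ℚ θ))
  exact_mod_cast IntermediateField.algebraMap_mem ℚ⟮θ⟯ a

/-- **Embedding with prescribed square root.**  If `θ² = d` (`d` squarefree `> 1`), `K = ℚ + ℚθ`, and `y² = d` in `ℚ_p`, there is a ring map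
`σ : K →+* ℚ_p` with `σ θ = y`: `y` is a root of `minpoly ℚ θ = X² − d`, so Mathlib's `IntermediateField.algHomAdjoinIntegralEquiv` gives
`ℚ⟮θ⟯ →ₐ[ℚ] ℚ_p` with `θ ↦ y`, and `ℚ⟮θ⟯ = ⊤ ≃ K`.  [folklore] -/
theorem exists_ringHom_apply_eq (d : ℕ) (hd : Squarefree d) (h1 : 1 < d) (θ : K) (hθ : θ ^ 2 = (d : K))
    (hgen : ∀ x : K, ∃ a b : ℚ, x = a + b • θ) {p : ℕ} [Fact p.Prime] (y : ℚ_[p]) (hy : y ^ 2 = (d : ℚ_[p])) :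
    ∃ σ : K →+* ℚ_[p], σ θ = y := by
  have hint : IsIntegral ℚ θ := .of_finite ℚ θ
  have hmin := minpoly_eq_X_sq_sub_C d hd h1 θ hθ
  have hy' : y ∈ (minpoly ℚ θ).aroots ℚ_[p] := by
    rw [mem_aroots, hmin]
    exact ⟨(monic_X_pow_sub_C _ two_ne_zero).ne_zero, by simp [hy]⟩
  set φ : ℚ⟮θ⟯ →ₐ[ℚ] ℚ_[p] := (algHomAdjoinIntegralEquiv ℚ hint).symm ⟨y, hy'⟩ with hφdef
  have hφ : φ (AdjoinSimple.gen ℚ θ) = y := algHomAdjoinIntegralEquiv_symm_apply_gen ℚ hint ⟨y, hy'⟩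
  have htop := adjoin_simple_eq_top θ hgen
  set e : ℚ⟮θ⟯ ≃ₐ[ℚ] K := (equivOfEq htop).trans topEquiv with hedef
  have he : e (AdjoinSimple.gen ℚ θ) = θ := rfl
  refine ⟨(φ.comp (e.symm : K →ₐ[ℚ] ℚ⟮θ⟯)).toRingHom, ?_⟩
  have hsymm : e.symm θ = AdjoinSimple.gen ℚ θ := by
    rw [AlgEquiv.symm_apply_eq, he]
  simp [hsymm, hφ]

/-! ## §4 The dealt statements -/

/-- **`K2E1RealQuadraticTwoPlacesAboveP` (dealt BY NAME, K2E1-plan (g0) 2026-09-03T21:22:33Z).**  Let `d ∈ ℕ` be squarefree with `1 < d`, `p` a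
prime such that `d` is a square in `ℚ_p`, and `K` ANY model of the real quadratic field `ℚ(√d)` — a number field with `θ ∈ K`, `θ² = d`, and
`K = ℚ + ℚθ`.  Then there are TWO DISTINCT height-one primes `v₁ ≠ v₂` of `𝓞 K` lying above `p` (`(p : 𝓞 K) ∈ vᵢ.asIdeal`), i.e. `p` splits in `K`.
Proof: `x² = d` in `ℚ_p`; embeddings `σ± : K → ℚ_p` with `θ ↦ ±x` (`exists_ringHom_apply_eq`); their places `v±` (`exists_heightOneSpectrum_of_ringHom`);
`v₊ ≠ v₋` by the separating integer of `exists_separating_odd` (`p ≠ 2`) ∕ `exists_separating_two` (`p = 2`).  Input №2 of HELD row 21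
`K2E1TransportRealQuadratic`; consumes ★ `K2E1RealQuadraticSplitAtP`.  [folklore] -/
theorem RealQuadraticTwoPlacesAboveP (d : ℕ) (hd : Squarefree d) (h1 : 1 < d) (p : ℕ) [Fact p.Prime]
    (hsq : IsSquare ((d : ℕ) : ℚ_[p])) (K : Type*) [Field K] [NumberField K] (θ : K) (hθ : θ ^ 2 = (d : K))
    (hgen : ∀ x : K, ∃ a b : ℚ, x = a + b • θ) :
    ∃ v₁ v₂ : IsDedekindDomain.HeightOneSpectrum (𝓞 K),
      v₁ ≠ v₂ ∧ ((p : ℤ) : 𝓞 K) ∈ v₁.asIdeal ∧ ((p : ℤ) : 𝓞 K) ∈ v₂.asIdeal := by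
  obtain ⟨x, hx⟩ := hsq
  have hx2 : x ^ 2 = (d : ℚ_[p]) := by rw [sq]; exact hx.symm
  have hx2' : (-x) ^ 2 = (d : ℚ_[p]) := by rw [neg_sq]; exact hx2
  obtain ⟨σ₁, hσ₁⟩ := exists_ringHom_apply_eq d hd h1 θ hθ hgen x hx2
  obtain ⟨σ₂, hσ₂⟩ := exists_ringHom_apply_eq d hd h1 θ hθ hgen (-x) hx2'
  obtain ⟨v₁, hp₁, hv₁⟩ := exists_heightOneSpectrum_of_ringHom σ₁
  obtain ⟨v₂, hp₂, hv₂⟩ := exists_heightOneSpectrum_of_ringHom σ₂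
  refine ⟨v₁, v₂, ?_, hp₁, hp₂⟩
  obtain ⟨u, hu⟩ : ∃ u : 𝓞 K, ¬ (‖σ₁ u‖ < 1 ↔ ‖σ₂ u‖ < 1) := by
    rcases eq_or_ne p 2 with rfl | hp2
    · exact exists_separating_two d hd θ hθ x hx2 σ₁ σ₂ hσ₁ hσ₂
    · exact exists_separating_odd hp2 d hd θ hθ x hx2 σ₁ σ₂ hσ₁ hσ₂
  intro heq
  apply hu
  rw [← hv₁, ← hv₂, heq]

/-- **`ℚ(√d)` is totally real** (dealer's third item).  If `θ² = d` with `d ∈ ℕ` and `K = ℚ + ℚθ` then every complex embedding of `K` is real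
(`(φθ)² = d ≥ 0` forces `im φθ = 0`), i.e. `NumberField.IsTotallyReal K`.  No squarefree ∕ `1 < d` hypothesis is needed.  [folklore] -/
theorem RealQuadraticIsTotallyReal (d : ℕ) (K : Type*) [Field K] [NumberField K] (θ : K) (hθ : θ ^ 2 = (d : K))
    (hgen : ∀ x : K, ∃ a b : ℚ, x = a + b • θ) : IsTotallyReal K := by
  have hreal : ∀ φ : K →+* ℂ, ComplexEmbedding.IsReal φ := by
    intro φ
    have hc : starRingEnd ℂ (φ θ) = φ θ := by
      have h2 : (φ θ) ^ 2 = (d : ℂ) := by rw [← map_pow, hθ, map_natCast]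
      rw [Complex.conj_eq_iff_im]
      have hre : (φ θ).re * (φ θ).re - (φ θ).im * (φ θ).im = d := by
        have := congrArg Complex.re h2
        simpa [sq, Complex.mul_re] using this
      have him : (φ θ).re * (φ θ).im + (φ θ).im * (φ θ).re = 0 := by
        have := congrArg Complex.im h2
        simpa [sq, Complex.mul_im] using this
      have him' : (φ θ).re * (φ θ).im = 0 := by linarith
      rcases mul_eq_zero.mp him' with hre0 | him0
      · rw [hre0, zero_mul, zero_sub] at hre
        have hd0 : (0 : ℝ) ≤ d := Nat.cast_nonneg d
        exact mul_self_eq_zero.mp (le_antisymm (by linarith [mul_self_nonneg (φ θ).im]) (mul_self_nonneg _))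
      · exact him0
    rw [ComplexEmbedding.isReal_iff]
    ext1 y
    rw [ComplexEmbedding.conjugate_coe_eq]
    obtain ⟨a, b, rfl⟩ := hgen y
    simp [Rat.smul_def, hc]
  exact ⟨fun w => InfinitePlace.isReal_iff.mpr (hreal _)⟩

end Summit.HodgeConjecture.HodgeConjecture.Cruxes.H413.K2E1RealQuadraticTwoPlacesAboveP
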